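import Literature.NumberTheory.EllipticCurves.AnticyclotomicSignedCompactSelmer
import Literature.NumberTheory.EllipticCurves.PlusMinusPAdicLFunction
import HarnessLib

/-!
# Castella–Wan's signed `Λ^ac`-adic Heegner classes `z^±_∞ ∈ Sel_±(K, 𝐓^ac)` (Def. 4.5) as a PINNING
# PREDICATE on the compact signed carriers, `char_{Λac}(Sel_±(K, 𝐓^ac)/Λ^ac z^±_∞)`, and the printed
# theorems about them (Prop. 4.4 / Def. 4.5 / Lemma 4.7, Thm. A.5) as named facts

Topic `Literature/NumberTheory/EllipticCurves`; namespace `Literature.NumberTheory.EllipticCurves.AcSigned`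
(the object namespace of `AnticyclotomicSignedSelmer.lean` (discrete carriers, duals `X`) and
`AnticyclotomicSignedCompactSelmer.lean` (compact carriers `selmerTorsion`, `selmerLambdaAdic`, the
`ℤ_p⟦T⟧`-structure `moduleOfGen`, truncated action `tsmul`), which this file continues). Cell
`pub/bsd-wall` (rung W-ALL of the BSD summit), literature-typer seat `bsd-wall-utd-ty1` (successor
generation; director-bsd g12 (142)(e)), `--supports` stmt-BirchSwinnertonDyer-23594 = crux
`TwinSplitIMCAtThreeGoodSSApZero` of the route `UniversalToricDescent`, whose `⊇`/Howard half is a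
PORT to `p = 3`, `a_3 = 0` of Castella–Wan's argument "`z^±_∞ ∈ Sel_±(K, 𝐓^ac)` + Kolyvagin system
(Thm. A.4/A.5) + explicit reciprocity law (Thm. 6.2) ⟹ (6.14)–(6.15)". HONEST FRAMING: DEFINITIONS
with bodies (a polynomial, three predicates, one ideal) + TWO statement-only named facts (`def … :
Prop`, D-0014; hypotheses as printed — in particular `p > 3` VERBATIM —, specialised as documented;
nothing asserted, no `_holds`). The two facts are NOT usable at `p = 3`; they record, in print
currency and on the tree's carriers, the ENGINE the crux must re-prove at `p = 3`. Typed ≠ proved ≠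
endorsed; BSD is not advanced by this file; the crux stays open.

## What is typed here

1. (Part 1) `omegaTildeOpp p ε n ∈ Λ = ℤ_p⟦T⟧`: Castella–Wan's `ω̃^{-ε}_n` ((3.5): `ω̃^+_n = ∏_{2 ≤ m ≤
   n, m even} Φ_{p^m}(1+X)`, `ω̃^-_n = ∏_{1 ≤ m ≤ n, m odd} Φ_{p^m}(1+X)`, `ω_n = X ω̃^∓_n ω̃^±_n`) — the
   tree's `cyclotomicOmegaMinus p n` (for `ε = +`) resp. `cyclotomicOmegaPlus p n` (for `ε = −`)
   mapped to `ℤ_p⟦T⟧`; and the predicate `HeegnerFamily.IsTraceCoherentApZero F`: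
   `Tr_{K_{n+2}/K_{n+1}} z_{n+2} = −z_n` for the norm points `z_n = F.z n ∈ E(K_n)` of the tree's
   `HeegnerFamily` (Castella–Wan Prop. 4.1 ⟹ (4.1) "`Cor^{n+1}_n(z[Sp^{n+1}]) = −z[Sp^{n−1}]`" since
   `a_p = 0`; Hatley–Lei–Vigni §4.2 "`tr_{K_m/K_{m−1}}(z^±_m) = −z^±_{m−1}`" for `m ≡ ± (2)`). The
   tree's `HeegnerFamily` (Howard's span-based Heegner module) records each norm point separately;
   Castella–Wan's CLASS needs the coherence, so it is a hypothesis of the facts.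
2. (Part 2) **`IsSignedHeegnerClass p κ γ F ε z`** for a raw family `z ∈ ∏_n ∏_m H¹(K_n, E[p^m])`:
   for every layer `n` of parity `ε` and every `m`, the `(n, m)`-component of `ω̃^{-ε}_n(γ − 1) · z`
   (`tsmul`, i.e. `Λ^ac = ℤ_p⟦Y⟧`, `Y = γ − 1`, acting through `conj_γ − 1`) equals
   `(-1)^{⌊(n+1)/2⌋} · δ_{K_n}(z_n)`, the Kummer class of `F.z n` in `H¹(K_n, E[p^m])`
   (`kummerClassOver`, at any `p^m`-th root) — Castella–Wan Prop. 4.4 "`ω̃^{-ε}_n(Y) z_n[S]^ε =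
   Cor_n(z[Sp^{n+1−δ}])`" + Def. 4.5 "`z_∞[S]^ε := {z_n[S]^ε}_n ∈ lim←_{n ≡ ε} H¹(K[S], 𝐓^ac)/ω^ε_n(Y)
   ≃ H¹(K[S], 𝐓^ac)`" + p. 22 (`z^±_∞ ∈ H¹(K, 𝐓^ac)` by corestriction from `K[1]`), for `S = 1`,
   read through `ω̃^{-ε}_n ω^ε_n = ω_n` ((3.5)), `H¹(K, 𝐓^ac)/ω_n ↪ H¹(K^ac_n, T)` (Lemma 4.2, Shapiro
   (3.10)/§4.1) and `Y ↔ conj_γ − 1`: a predicate PINNING `z` to the family, nothing asserted;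
   **`signedHeegnerCharIdeal hγ ε z = char_{Λac}(Sel_ε(K, 𝐓^ac)/Λ^ac z)`** for `z ∈ selmerLambdaAdic
   … (sgn ε)` (the tree's `Module.charIdeal` of the quotient by `Λ^ac z`, under `moduleOfGen hγ`; the
   right-hand side of Conj. 4.8 (3) / Thm. A.5 (ii), the signed analogue of `heegnerCharIdeal`);
   `IsNonTorsionClass hγ ε z` (the shape of Conj. 4.8 (1) / Cor. 6.4).
3. (Part 3) two NAMED FACTS, `p > 3` VERBATIM (so NOT instantiable at `p = 3`):
   `castellaWan2024_prop44_exists_signedHeegnerClass` (Prop. 4.4 + Def. 4.5 + Lemma 4.7: for every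
   trace-coherent family and sign there is `z ∈ Sel_ε(K, 𝐓^ac)` with `IsSignedHeegnerClass`) and
   `castellaWan2024_thmA5_signedSelmer_rank_one_dvd_sq` (Thm. A.5 with Lemma 6.7 (1), `N`
   squarefree: `rank_{Λac} Sel_ε(K, 𝐓^ac) = rank_{Λac} X_ε = 1` and `char(X_{ε,tors}) ∣
   char(Sel_ε(K, 𝐓^ac)/Λ^ac z^ε_∞)²`, the form of the tree's `Howard2004_thmB`).

## Sources, VERBATIM (texts read by this seat 2026-08-28; locators)

* [CastellaWan2023] F. Castella, X. Wan, *Perrin-Riou's main conjecture for elliptic curves at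
  supersingular primes*, Math. Ann. 389 (2024) 2595–2636 = authors' accepted MS
  `paper:url-7157bd4f7b88` (journal p = MS p + 2594). **(3.5)** (MS p. 11) "`ω̃^+_n(X) := ∏_{2 ≤ m ≤
  n, m even} Φ_m(X+1)`, `ω̃^-_n(X) := ∏_{1 ≤ m ≤ n, m odd} Φ_m(X+1)`, where `Φ_m(X) = ∑_{i=0}^{p−1}
  X^{i p^{m−1}}` is the `p^m`-th cyclotomic polynomial. Set also `ω^±_n(X) = X ω̃^±_n(X)`, and note that
  `ω_n(X) := (X+1)^{p^n} − 1 = X ω̃^∓_n(X) ω̃^±_n(X)`". §4 (p. 17) "`E/ℚ` elliptic curve of conductor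
  `N`, `p > 3` is a prime of good supersingular reduction for `E` [so `a_p = 0`], and `K` is an
  imaginary quadratic field … (gen-H)". **Prop. 4.1** (p. 18; Heegner points `x_S ∈ E(K[S])` and
  their norm relations "`Tr_{K[Sℓ]/K[S]}(x_{Sℓ}) = a_ℓ x_S − x_{S/ℓ}` if `ℓ ∣ S`" …); "`z[S] ∈ H¹(K[S], T)`
  the image of `x_S` under the Kummer map"; **(4.1)** "Since `a_p = 0`, letting `Cor^{n+1}_n` denote
  the corestriction map for the extension `K[Sp^{n+1}]/K[Sp^n]`, the norm-compatibility in
  Proposition 4.1 yields `Cor^{n+1}_n(z[Sp^{n+1}]) = −z[Sp^{n−1}]` for all `n > 0`"; p. 18 "`L ⊂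
  K[p^∞]` the fixed field of `Γ^ac` and for each `n` let `L_{n+1}` be the subfield of `K[p^∞]` fixed
  by `(Γ^ac)^{p^n}` … there exists a non-negative integer `δ` such that `L_{n+1+δ} = K[p^n]` for
  `n ≫ 0`, with `δ = 0` when the class number of `K` is coprime to `p`"; §4.1 (p. 19) "we identify
  `Λ^ac` with the one variable power series ring `ℤ_p⟦Y⟧` setting `Y = γ^ac − 1`", **Lemma 4.2**
  (injectivity of `H¹(K[S], 𝐓̃)/ω_n(Y) ↪ H¹(K[Sp^{n+1−δ}], T)`), **Lemma 4.3** ("`H¹(K[S], 𝐓^ac)` is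
  free over `Λ^ac`"; proof via Lemma 6.6, `p > 3`); p. 20 "we let `Cor_n` be the corestriction map
  for `K[Sp^{n+1−δ}]/K^ac_n[S]`"; **Prop. 4.4** (p. 20) "Let `ε = (−1)^n`. There exists a unique class
  `z_n[S]^ε ∈ H¹(K[S], 𝐓^ac)/ω^ε_n(Y)H¹(K[S], 𝐓^ac)` such that `ω̃^{−ε}_n(Y) z_n[S]^ε =
  Cor_n(z[Sp^{n+1−δ}])`. Moreover, the sequences `{(−1)^{n/2} z_n[S]^+}_{n even}`, `{(−1)^{(n+1)/2}
  z_n[S]^−}_{n odd}` are compatible under the natural maps `H¹(K[S], 𝐓^ac)/ω^ε_n(Y) → H¹(K[S],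
  𝐓^ac)/ω^ε_{n−2}(Y)`"; **Def. 4.5** (p. 21) "`z_∞[S]^ε := {z_n[S]^ε}_n ∈ lim←_n H¹(K[S], 𝐓^ac)/
  ω^ε_n(Y)H¹(K[S], 𝐓^ac) ≃ H¹(K[S], 𝐓^ac)`, where the limit is over the positive integers `n` of
  parity `ε`"; **Lemma 4.7** (p. 22) "For each prime `v` of `K` above `p` we have `loc_v(z^±_∞) ∈
  H¹_±(K_v, 𝐓^ac)`"; p. 22 "Let `z^±_∞ ∈ H¹(K, 𝐓^ac)` denote the image of the class `z_∞[1]^±` under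
  the corestriction map. It follows from Lemma 4.7 that `z^±_∞` lands in `Sel_±(K, 𝐓^ac)`";
  **Conj. 4.8** (p. 22; a CONJECTURE, not vendored: "(1) … not `Λ^ac`-torsion. (2) … rank one.
  (3) `char_{Λac}(X_{±,tors}) = char_{Λac}(Sel_±(K, 𝐓^ac)/Λ^ac z^±_∞)²`"); **Cor. 6.4** (p. 27) "The
  class `loc_𝔭(z^±_∞)` is not `Λ^ac`-torsion"; **Lemma 6.7** (p. 28) "(1) `X_±` and `Sel_±(K, 𝐓^ac)`
  have the same `Λ^ac`-rank"; App. A (pp. 33–36): **Thm. A.4** "Let `ε ∈ {±}`. There exists a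
  Kolyvagin system `κ^ε ∈ KS(𝐓^ac, 𝓕_ε, 𝓛)` such that `κ^ε_1 = z^ε_∞`" (proof: [How04b, Thm. 2.3.1],
  [CH18, §4], [Kim07, Prop. 4.11] "replaced `p > 3`", [CW, Lem. 5.1]); **Thm. A.5** "Assume that `N`
  is squarefree. Then the module `Sel_±(K, 𝐓^ac)` has `Λ^ac`-rank one, and there is a finitely
  generated `Λ^ac`-module `M` such that: (i) `X_± ∼ Λ^ac ⊕ M ⊕ M`, (ii) We have the divisibility
  `char_{Λac}(M) ⊃ char_{Λac}(Sel_±(K, 𝐓^ac)/Λ^ac z^±_∞)` in `Λ^ac`" (proof: "`p^d κ^ε` … nontrivial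
  by Cor. 6.4 … [Edi97, Prop. 2.1] … [How04b, Thm. 2.2.2], [How04a, Thm. 2.2.10]").
* [HatleyLeiVigni2022] J. Hatley, A. Lei, S. Vigni, Manuscripta Math. 167 (2022), author TeX
  `paper:arxiv-2003.10301`, §4.2: "Let `{z_n ∈ E(K_n)}_{n ≥ 1}` be a compatible family of Heegner
  points as in [LV] … Since we have assumed that `a_p(E) = 0` … `tr_{K_m/K_{m−1}}(z^+_m) = −z^+_{m−1}`
  for every even `m ≥ 2`; … `tr_{K_m/K_{m−1}}(z^-_m) = −z^-_{m−1}` for every odd `m ≥ 3`" (with Def.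
  4.3 `z^+_m = z_m` (`m` even), `z^-_m = z_m` (`m` odd): `tr_{K_m/K_{m−1}} z_m = −z_{m−2}`, `m ≥ 2`).
* [Pollack2003] R. Pollack, Duke Math. J. 118 (2003), §6.5 (`ω^±_n`; the tree's
  `cyclotomicOmegaPlus/Minus`, file `PlusMinusPAdicLFunction.lean`).
* [Howard2004HeegnerKolyvagin] B. Howard, Compos. Math. 140 (2004), §3.3 (Kummer map, `H_k`); the
  tree's `HeegnerFamily`, `kummerClassOver`, `heegnerCharIdeal`, `Howard2004_thmB`
  (`HeegnerModuleIndex.lean`).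

## READING FLAGS (informational — where the transcription is a reading, not a printed sentence)

* `CW24-sign`: Def. 4.5 writes `z_∞[S]^ε := {z_n[S]^ε}_n`, which is an element of the inverse limit
  only for the COMPATIBLE normalisation of Prop. 4.4, `(−1)^{n/2} z_n^+` (`n` even), `(−1)^{(n+1)/2}
  z_n^−` (`n` odd) — both `= (−1)^{⌊(n+1)/2⌋} z_n^ε`; the predicate uses this normalisation
  (`(-1) ^ ((n + 1) / 2)`, natural-number division). A global sign change of `z^ε_∞` changes neither
  `Λ^ac z^ε_∞` nor any statement below.
* `delta-zero`: the facts assume `p ∤ h_K` (`AcSigned.Setting`), so `δ = 0`, `Cor_n` is the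
  corestriction `K[p^{n+1}] → K^ac_n` and `Cor_n(z[p^{n+1}])` is the Kummer image of
  `Norm_{K[p^{n+1}]/K_n} x_{p^{n+1}}` = the tree's `F.z n` ("`z j = Norm_{K[p^{j+1}]/K_j} P[p^{j+1}]`").
  (The MS sentence "`L_{n+1+δ} = K[p^n]`" is read with `K^ac_n ⊂ K[p^{n+1}]`, the containment the
  definition of `Cor_n` requires.)
* `coherent-family`: Castella–Wan's `z[S]` come from ONE system `{x_S}` (Prop. 4.1), whence (4.1);
  the tree's `HeegnerFamily` only records norm points, so the coherence `Tr z_{n+2} = −z_n`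
  (`IsTraceCoherentApZero`) is an explicit hypothesis; the layer identities `K[p^{n+2}] = K_{n+1}
  K[p^{n+1}]`, `K[p^{n+1}] ∩ K_∞ = K_n` (for `p ∤ h_K`) behind "`Cor ∘ Kummer = Kummer ∘ Norm`" are
  part of the reading, not formalised.
* `Shapiro`/`Y-action`: `H¹(K, 𝐓^ac) = lim←_n H¹(K^ac_n, T)` ((3.10)/§4.1) with `Y = γ^ac − 1` acting as
  `conj_γ − 1` (`γ` a topological generator lifting `γ^ac`), and `H¹(K^ac_n, T) = lim←_m H¹(K^ac_n,
  E[p^m])` — the identifications of `AnticyclotomicSignedCompactSelmer.lean` (`lambdaAdic`,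
  `tsmul`) and of the tree's `LambdaAdicSelmerData`.
* `CW24-local-condition`, `away-p-compact`, `HLV-vs-Kob-layers`: inherited (the carriers
  `selmerLambdaAdic … (sgn ε)` use Hatley–Lei–Vigni's finite-level conditions; see the sibling file).
* `N⁻ = 1`: the facts are transcribed under the classical Heegner hypothesis
  (`SatisfiesHeegnerHypothesis N K`, modular curve `X₀(N)`, the setting of the tree's `HeegnerFamily`);
  TODO(general form): (gen-H) with Shimura-curve parametrisations as printed.

## NOT in this file (and why)

* No existence of `z^±_∞` is proved or assumed outside the named fact (Prop. 4.4 needs Lemma 4.3,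
  freeness of `H¹(K[S], 𝐓^ac)`, printed for `p > 3`); no uniqueness lemma (it would need the
  injectivity of Lemma 4.2 on the tree's carriers). Conj. 4.8, Conj. 5.2 are conjectures — never
  Literature facts. Thm. 6.2 (explicit reciprocity law), Cor. 6.4, Thm. 6.8 and (6.14)–(6.15) need
  `Log^±_v`, `L_p^{BDP}` on `Λ^ur` and local Iwasawa cohomology (not typed here); Thm. A.4 needs
  Kolyvagin systems (`KS(𝐓^ac, 𝓕_±, 𝓛)`, not typed).
* No instance, no notation: the `Λ`-module structure is activated locally (`letI := moduleOfGen …`).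
-/

noncomputable section

open scoped Classical

open NumberField IsDedekindDomain Field Polynomial
open Literature.NumberTheory.EllipticCurves Literature.NumberTheory.GaloisRepresentations
open Literature.NumberTheory.EllipticCurves.Kobayashi2003
open Literature.NumberTheory.EllipticCurves.IwasawaDual
open WeierstrassCurve (geomTorsion geomPoints)

universe u

namespace Literature.NumberTheory.EllipticCurves.AcSigned

/-! ## Part 1. `ω̃^{∓}_n` in `Λ = ℤ_p⟦T⟧` and trace-coherent Heegner families at `a_p = 0` -/

section Omega

variable (p : ℕ) [Fact p.Prime]

/-- **`ω̃^{-ε}_n(T) ∈ ℤ_p⟦T⟧`**, the "opposite-sign" half of `ω_n/T = ∏_{1 ≤ m ≤ n} Φ_{p^m}(1+T)`: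
for `ε = +` it is `ω̃^-_n = ∏_{1 ≤ m ≤ n, m odd} Φ_{p^m}(1+T)` (the tree's `cyclotomicOmegaMinus`), for
`ε = -` it is `ω̃^+_n = ∏_{2 ≤ m ≤ n, m even} Φ_{p^m}(1+T)` (`cyclotomicOmegaPlus`), mapped into
`Λ = ℤ_p⟦T⟧` — the multiplier of Castella–Wan's Prop. 4.4: "a unique class `z_n[S]^ε ∈
H¹(K[S], 𝐓^ac)/ω^ε_n` such that `ω̃^{-ε}_n(Y) z_n[S]^ε = Cor_n(z[Sp^{n+1-δ}])`" (their `ω̃^±_n(X) :=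
∏ Φ_m(X+1)`, MS p. 11, (3.5) `ω_n = X ω̃^∓_n ω̃^±_n`).
[cite: CastellaWan2023, (3.5) and Prop. 4.4 (MS pp. 11, 20)] [cite: Pollack2003, §6.5 (display before Prop. 6.18)] -/
def omegaTildeOpp (ε : ℤˣ) (n : ℕ) : IwasawaAlgebra p :=
  (((if ε = 1 then cyclotomicOmegaMinus p n else cyclotomicOmegaPlus p n).map
    (Int.castRingHom ℤ_[p]) : ℤ_[p][X]) : PowerSeries ℤ_[p])

/-- For `ε = 1` (plus) the multiplier is `ω̃^-_n`. [cite: CastellaWan2023, Prop. 4.4 (MS p. 20)] -/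
theorem omegaTildeOpp_one (n : ℕ) : omegaTildeOpp p 1 n =
    (((cyclotomicOmegaMinus p n).map (Int.castRingHom ℤ_[p]) : ℤ_[p][X]) : PowerSeries ℤ_[p]) := by
  simp [omegaTildeOpp]

/-- For `ε = -1` (minus) the multiplier is `ω̃^+_n`. [cite: CastellaWan2023, Prop. 4.4 (MS p. 20)] -/
theorem omegaTildeOpp_neg_one (n : ℕ) : omegaTildeOpp p (-1) n =
    (((cyclotomicOmegaPlus p n).map (Int.castRingHom ℤ_[p]) : ℤ_[p][X]) : PowerSeries ℤ_[p]) := by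
  simp [omegaTildeOpp]

end Omega

section Coherent

variable {K : Type u} [Field K] [NumberField K] {N : ℕ} [NeZero N] {W : WeierstrassCurve ℚ}
  {p : ℕ} [Fact p.Prime] {κ : ZpExtension K p} {jbar : AlgebraicClosure K →+* ℂ}

/-- **Trace-coherence of a Heegner family at `a_p = 0`**: `Tr_{K_{n+2}/K_{n+1}}(z_{n+2}) = -z_n` for
all `n`, the traces being sums over a transversal `R ⊆ Gal(K̄/K_{n+1})` of `Gal(K̄/K_{n+2})` (as in
`IsHeegnerNormPoint`). This is the norm relation of a COMPATIBLE system of Heegner points of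
`p`-power conductor when `a_p = 0`: Castella–Wan Prop. 4.1 "`Tr_{K[ℓS]/K[S]}(x_{ℓS}) = a_ℓ x_S − x_{S/ℓ}`
if `ℓ ∣ S`", whence (4.1) "`Cor^{n+1}_n(z[Sp^{n+1}]) = −z[Sp^{n−1}]` … since `a_p = 0`", traced down to
the layers (`Gal(K[p^{n+2}]/K_{n+1}) → Gal(K[p^{n+1}]/K_n)` is a bijection when `p ∤ h_K`); Hatley–
Lei–Vigni §4.2 ("a compatible family of Heegner points as in [LV]", with the relations listed
there). The tree's `HeegnerFamily` records each `z_n = Norm_{K[p^{n+1}]/K_n} P[p^{n+1}]` separately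
(enough for Howard's span-based Heegner module); Castella–Wan's CLASS needs the coherence, so it is
a hypothesis where used. [cite: CastellaWan2023, Prop. 4.1 and (4.1) (MS p. 18)]
[cite: HatleyLeiVigni2022, §4.2 (relations after Def. 4.3)] -/
def _root_.Literature.NumberTheory.EllipticCurves.HeegnerFamily.IsTraceCoherentApZero
    (F : HeegnerFamily N W K κ jbar) : Prop :=
  ∀ (n : ℕ) (R : Finset (absoluteGaloisGroup K)),
    (↑R ⊆ (κ.layerSubgroup (n + 1) : Set (absoluteGaloisGroup K))) →
    (∀ τ ∈ κ.layerSubgroup (n + 1), ∃! r, r ∈ R ∧ r⁻¹ * τ ∈ κ.layerSubgroup (n + 2)) →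
      ∑ r ∈ R, r • F.z (n + 2) = -F.z n

end Coherent

/-! ## Part 2. The pinning predicate for `z^ε_∞` and `char_{Λac}(Sel_ε(K, 𝐓^ac)/Λ^ac z^ε_∞)` -/

section Heegner

variable {K : Type u} [Field K] [NumberField K] {N : ℕ} [NeZero N] {W : WeierstrassCurve ℚ}
  (p : ℕ) [Fact p.Prime] (κ : ZpExtension K p) (γ : absoluteGaloisGroup K)
  {jbar : AlgebraicClosure K →+* ℂ}

/-- **`z` is the `ε`-signed `Λ^ac`-adic Heegner class of the family `F`** (Castella–Wan Def. 4.5 with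
Prop. 4.4 and (4.1), for `S = 1`, corestricted from `K[1]` to `K` as on MS p. 22, in the case
`δ = 0`, i.e. `p ∤ h_K`, where `Cor_n` is the corestriction `K[p^{n+1}] → K^ac_n`): for every
layer `n` of parity `ε` (`(-1)^n = ε`) and every `m`, the level-`(n, m)` component of
`ω̃^{-ε}_n(γ − 1) · z` (the polynomial `omegaTildeOpp p ε n` acting through the truncated action
`tsmul`, i.e. through `Λ^ac = ℤ_p⟦Y⟧`, `Y = γ − 1`) is `(-1)^{⌊(n+1)/2⌋}` times the Kummer class
`δ_{K_n}(z_n) ∈ H¹(K_n, E[p^m])` of the norm point `z_n = Norm_{K[p^{n+1}]/K_n} P[p^{n+1}] = F.z n`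
(`kummerClassOver` at any `p^m`-th root `Q` of `F.z n`; the class does not depend on `Q`). Printed:
Prop. 4.4 "There exists a unique class `z_n[S]^ε ∈ H¹(K[S], 𝐓^ac)/ω^ε_n(Y)H¹(K[S], 𝐓^ac)` such that
`ω̃^{-ε}_n(Y) z_n[S]^ε = Cor_n(z[Sp^{n+1-δ}])`. Moreover, the sequences `{(-1)^{n/2} z_n[S]^+}_{n even}`,
`{(-1)^{(n+1)/2} z_n[S]^-}_{n odd}` are compatible"; Def. 4.5 "`z_∞[S]^ε := {z_n[S]^ε}_n ∈ lim←_n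
H¹(K[S], 𝐓^ac)/ω^ε_n(Y) ≃ H¹(K[S], 𝐓^ac)`, where the limit is over the positive integers `n` of
parity `ε`"; p. 22 "Let `z^±_∞ ∈ H¹(K, 𝐓^ac)` denote the image of the class `z_∞[1]^±` under the
corestriction map"; `z[S]` = Kummer image of the Heegner point `x_S` (Prop. 4.1). READINGS (flags
`CW24-sign`, `delta-zero`, `coherent-family`): the compatible normalisation `(-1)^{⌊(n+1)/2⌋}` of
Prop. 4.4 is the one defining the limit; `δ = 0`; `Cor_n ∘ Kummer = Kummer ∘ Norm`. A predicate on
a raw family `z ∈ ∏_n ∏_m H¹(K_n, E[p^m])` (membership in `Sel_ε(K, 𝐓^ac) = selmerLambdaAdic` is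
stated separately); nothing asserted. [cite: CastellaWan2023, Prop. 4.4, Def. 4.5 and §4.2 p. 22 (MS pp. 20–22)] -/
def IsSignedHeegnerClass (F : HeegnerFamily N W K κ jbar) (ε : ℤˣ)
    (z : Π n m : ℕ, (W.baseChange K).torsionH1Over ((p : ℤ) ^ m) (κ.layerSubgroup n)) : Prop :=
  ∀ n : ℕ, (-1 : ℤˣ) ^ n = ε →
    ∀ (m : ℕ) (Q : geomPoints (W.baseChange K)) (hQ : ((p : ℤ) ^ m) • Q = F.z n),
      tsmul (W.baseChange K) p κ γ (omegaTildeOpp p ε n) z n m =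
        ((-1 : ℤ) ^ ((n + 1) / 2)) • (W.baseChange K).kummerClassOver (κ.layerSubgroup n)
          ((p : ℤ) ^ m) Q (fun σ hσ ↦ by rw [hQ]; exact (F.isHeegnerNormPoint_z n).smul_eq_self hσ)

variable {p κ γ}

/-- **`char_{Λac}(Sel_ε(K, 𝐓^ac)/Λ^ac z)`** for an element `z` of the compact signed Selmer module
(`selmerLambdaAdic … (fun _ ↦ .sgn ε)` with the module structure `moduleOfGen hγ`): the
characteristic ideal (the tree's `Module.charIdeal`) of the quotient by the cyclic submodule
`Λ^ac z` — the right-hand side of Castella–Wan's Conj. 4.8 (3) / Thm. 6.8 (i) / Thm. A.5 (ii)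
"`char_{Λac}(Sel_±(K, 𝐓^ac)/Λ^ac z^±_∞)`" when `z = z^ε_∞` (`IsSignedHeegnerClass`); the signed
analogue of the tree's `heegnerCharIdeal D F`. [cite: CastellaWan2023, Conj. 4.8 (3) and Thm. A.5 (ii) (MS pp. 22, 36)] -/
def signedHeegnerCharIdeal (hγ : κ.IsTopGenerator γ) (ε : ℤˣ)
    (z : selmerLambdaAdic (W.baseChange K) p κ γ (fun _ ↦ .sgn ε)) : Ideal (IwasawaAlgebra p) :=
  letI := selmerLambdaAdic.moduleOfGen (W.baseChange K) p κ γ hγ (fun _ ↦ PCond.sgn ε)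
  Module.charIdeal (IwasawaAlgebra p)
    (selmerLambdaAdic (W.baseChange K) p κ γ (fun _ ↦ .sgn ε) ⧸
      Submodule.span (IwasawaAlgebra p) {z})

/-- **"`z` is not `Λ^ac`-torsion"** in `Sel_ε(K, 𝐓^ac)` (`f • z = 0 ⟹ f = 0` under `moduleOfGen hγ`)
— the shape of Castella–Wan Conj. 4.8 (1) / Cor. 6.4 ("The class `loc_𝔭(z^±_∞)` is not
`Λ^ac`-torsion"). A predicate; nothing asserted. [cite: CastellaWan2023, Conj. 4.8 (1) and Cor. 6.4 (MS pp. 22, 27)] -/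
def IsNonTorsionClass (hγ : κ.IsTopGenerator γ) (ε : ℤˣ)
    (z : selmerLambdaAdic (W.baseChange K) p κ γ (fun _ ↦ .sgn ε)) : Prop :=
  letI := selmerLambdaAdic.moduleOfGen (W.baseChange K) p κ γ hγ (fun _ ↦ PCond.sgn ε)
  ∀ f : IwasawaAlgebra p, f • z = 0 → f = 0

end Heegner

/-! ## Part 3. The printed theorems on the signed Heegner classes (named facts; statements only,
hypotheses as printed — `p > 3` VERBATIM —, specialised as documented) -/

section Facts

variable (N : ℕ) [NeZero N] (W : WeierstrassCurve ℚ) [W.IsGloballyMinimal] (K : Type) [Field K]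
  [NumberField K] (p : ℕ) [Fact p.Prime] (κ : ZpExtension K p) (𝔭 𝔭' : HeightOneSpectrum (𝓞 K))
  (jbar : AlgebraicClosure K →+* ℂ)

/-- **Castella–Wan 2024, Prop. 4.4 + Def. 4.5 + Lemma 4.7: the signed Heegner classes `z^±_∞` EXIST
and lie in `Sel_±(K, 𝐓^ac)`.** Printed: Prop. 4.4 / Def. 4.5 (quoted at `IsSignedHeegnerClass`),
construction resting on Lemma 4.2 and Lemma 4.3 ("`H¹(K[S], 𝐓^ac)` is free over `Λ^ac`", via Lemma
6.6: `E[p]` absolutely irreducible over `G_K`); Lemma 4.7 "For each prime `v` of `K` above `p` we have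
`loc_v(z^±_∞) ∈ H¹_±(K_v, 𝐓^ac)`", and "it follows from Lemma 4.7 that `z^±_∞` lands in
`Sel_±(K, 𝐓^ac)`" (§4.2). Standing hypotheses of §4: `E/ℚ` elliptic of conductor `N`, `K` imaginary
quadratic with (gen-H), `p > 3` of good supersingular reduction (so `a_p = 0`), (spl) `p = 𝔭𝔭̄`
split. TRANSCRIBED (special case, flags `delta-zero`, `coherent-family`, `CW24-local-condition`,
`away-p-compact`, `HLV-vs-Kob-layers`): `N⁻ = 1` (classical Heegner hypothesis
`SatisfiesHeegnerHypothesis N K`; TODO(general form): (gen-H) with Shimura curves), `p ∤ h_K`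
(`AcSigned.Setting`, so `δ = 0`), `3 < p` verbatim, for every topological generator `γ`, every
`jbar`, every TRACE-COHERENT Heegner family `F` of level `N = N_E` (the compatible systems of
Prop. 4.1) and every sign: there is `z ∈ Sel_ε(K, 𝐓^ac)` (the tree's `selmerLambdaAdic`, finite-level
conditions of Hatley–Lei–Vigni) which is the `ε`-signed Heegner class of `F`
(`IsSignedHeegnerClass`). NOT usable at `p = 3` (printed `p > 3`; Lemma 4.3/6.6 use it).
[cite: CastellaWan2023, Prop. 4.4, Def. 4.5, Lemma 4.7 and §4 standing hypotheses (MS pp. 17–22)]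
[cite: HatleyLeiVigni2022, Prop. 3.2 (b) and Remark 3.1] -/
def castellaWan2024_prop44_exists_signedHeegnerClass : Prop :=
  ∀ (_ : Setting W K p κ 𝔭 𝔭'), (W.conductorNorm ℤ : ℕ) = N → SatisfiesHeegnerHypothesis N K →
    3 < p → ∀ (γ : absoluteGaloisGroup K), κ.IsTopGenerator γ →
    ∀ (F : HeegnerFamily N W K κ jbar), F.IsTraceCoherentApZero → ∀ ε : ℤˣ,
      ∃ z ∈ selmerLambdaAdic (W.baseChange K) p κ γ (fun _ ↦ .sgn ε),
        IsSignedHeegnerClass p κ γ F ε z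

/-- **Castella–Wan 2024, Thm. A.5 (the Kolyvagin-system bound for the signed Heegner classes; with
Lemma 6.7 (1)).** Printed (App. A, in the setting of §6: `E/ℚ` of conductor `N`, `p > 3` of good
supersingular reduction, `K` imaginary quadratic with (gen-H) and (spl)): "Assume that `N` is
squarefree. Then the module `Sel_±(K, 𝐓^ac)` has `Λ^ac`-rank one, and there is a finitely generated
`Λ^ac`-module `M` such that: (i) `X_± ∼ Λ^ac ⊕ M ⊕ M`, (ii) We have the divisibility `char_{Λac}(M) ⊃
char_{Λac}(Sel_±(K, 𝐓^ac)/Λ^ac z^±_∞)` in `Λ^ac`" (proof from Thm. A.4's Kolyvagin system `p^d κ^±`,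
`κ^±_1 = z^±_∞`, non-trivial by Cor. 6.4; [Kim07, Prop. 4.11] self-duality of the `±` conditions,
[Edi97, Prop. 2.1] surjectivity of `G_ℚ → Aut(E[p])` for `N` squarefree and `p` supersingular,
[How04b, Thm. 2.2.2], [How04a, Thm. 2.2.10]); Lemma 6.7 (1): "`X_±` and `Sel_±(K, 𝐓^ac)` have the same
`Λ^ac`-rank". TRANSCRIBED (special case as in `castellaWan2024_prop44_exists_signedHeegnerClass`:
`N⁻ = 1`, `p ∤ h_K`, `3 < p` VERBATIM, `N` squarefree) for every `z ∈ Sel_ε(K, 𝐓^ac)` which is the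
`ε`-signed Heegner class of a trace-coherent Heegner family of level `N` (`IsSignedHeegnerClass`),
through consequences invariant under the printed pseudo-isomorphism, on the tree's carriers:
`Sel_ε(K, 𝐓^ac) = selmerLambdaAdic … (sgn ε)` is finitely generated of rank one
(`selmerLambdaAdic.HasRank … 1`; finite generation of `H¹(K, 𝐓^ac)` as in the proof of Lemma 4.2 /
[PR00] is recorded, reflexivity is not); the Pontryagin dual `X_ε = AcSigned.X … ∅ (sgn ε)` of
`Sel_ε(K, 𝐀^ac)` (`AnticyclotomicSignedSelmer.lean`; flag `CW24-local-condition`) is finitely generated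
of rank one and `char_{Λac}(X_{ε,Λ-tors}) = char(M)²` DIVIDES `char_{Λac}(Sel_ε(K, 𝐓^ac)/Λ^ac z)²`
(`X.torsionCharIdeal ∣ (signedHeegnerCharIdeal …)^2`, the form of the tree's `Howard2004_thmB`;
(i)'s finer shape `X_tors ∼ M ⊕ M` is not recorded — weaker, never stronger). NOT usable at `p = 3`:
this is the ENGINE statement of the crux's `⊇`-port, recorded in print currency.
[cite: CastellaWan2023, Thm. A.5, Thm. A.4 and Lemma 6.7 (1) (journal App. A; MS pp. 28, 35–36)] -/
def castellaWan2024_thmA5_signedSelmer_rank_one_dvd_sq : Prop :=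
  ∀ (_ : Setting W K p κ 𝔭 𝔭'), (W.conductorNorm ℤ : ℕ) = N → Squarefree N →
    SatisfiesHeegnerHypothesis N K → 3 < p → ∀ (γ : absoluteGaloisGroup K) (hγ : κ.IsTopGenerator γ)
    (F : HeegnerFamily N W K κ jbar), F.IsTraceCoherentApZero → ∀ (ε : ℤˣ)
    (z : selmerLambdaAdic (W.baseChange K) p κ γ (fun _ ↦ .sgn ε)),
      IsSignedHeegnerClass p κ γ F ε z.1 →
      selmerLambdaAdic.HasRank (W.baseChange K) p κ γ hγ (fun _ ↦ .sgn ε) 1 ∧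
      X.HasRank (W.baseChange K) p κ ∅ (fun _ ↦ .sgn ε) hγ 1 ∧
      X.torsionCharIdeal (W.baseChange K) p κ ∅ (fun _ ↦ .sgn ε) hγ ∣
        signedHeegnerCharIdeal hγ ε z ^ 2

end Facts

end Literature.NumberTheory.EllipticCurves.AcSigned

end
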